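import Literature.MathematicalPhysics.KineticTheory.HierarchyDuhamelBlocks
import HarnessLib

/-!
# Pruning of super-exponential collision trees: the remainder estimate (BGSR Proposition 4.3)
(Bodineau–Gallagher–Saint-Raymond, Invent. Math. 203 (2016) = arXiv:1305.3397v2, §4.4
"Estimates of the remainders", Proposition 4.3 with (4.13)–(4.17), pp. 13–14; trunk T-KINETIC,
topic MathematicalPhysics/KineticTheory; layer N4b of the bottom-up proof plan of the named fact
`bgsr_theorem22` / fact (c) `bodineau_gallagher_saintRaymond_linear` recorded in
`TaggedSphereLinearBoltzmann`, on top of the algebra of the pruned expansion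
(`HierarchyDuhamelBlocks`, N4a) and the continuity estimates (`HierarchyContinuityEstimates`, N3).)

BGSR Proposition 4.3 (p. 13): *"Under the assumptions of Theorem 2.2, the following holds. Let
`A ≥ 2` be given and define `n_k := A^k` for `k ≥ 1`. Then there exist `c, C, γ₀ > 0` depending on
`d`, `A` and `β` such that for any `t > 1` and any `γ ≤ γ₀`, choosing
`h ≤ cγ / (α^{A/(A-1)} t^{1/(A-1)})` and `K = t/h` integer ((4.13)), we get
`‖R_N^K(t)‖_{L^∞(T^d × ℝ^d)} + ‖R_α^{0,K}(t)‖_{L^∞(T^d × ℝ^d)} ≤ C γ^A ‖ρ⁰‖_{L^∞}` ((4.14))."*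
Here `R_N^K`, `R_α^{0,K}` are the remainders of the pruned expansions (4.8)–(4.12) of the first
marginal of the BBGKY, resp. Boltzmann, hierarchy into `K = t/h` blocks of duration `h`, block `k`
keeping the collision trees with fewer than `n_k` branchings (the tree's
`HierarchyModel.IsMildSolution.blockComp_spec`: `F^{(1)}(t) = (blockComp K [F(0)])^{(1)} +
∑_{i<K} (blockComp i [Rem_i])^{(1)}`, `Rem_i = iterRem M F (t - (i+1)h) (n_{i+1})`), and the only
input on the solutions is the uniform a priori bound (4.6)/(4.7)
`sup_t ‖F^{(k)}(t)‖_{k,β} ≤ C^k ‖ρ⁰‖_{L^∞}` (BGSR Prop. 4.1 and Remark 3.5).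

This file PROVES the proposition ONCE for an abstract hierarchy (`HierarchyModel`: BBGKY and
Boltzmann are the instances `bbgkyModel`, `boltzmannModel` of N4a, the rate `α` being part of the
collision operator and hence of the constant `M.opConst` of the single-step estimate (4.5) of Lemma 4.2) and
for any family `F` obeying an a priori bound `|F^{(k)}(τ, Z_k)| ≤ R₀ C₀^k e^{-β H_k(Z_k)}` on
`[0, T]` (`R₀ = ‖ρ⁰‖_∞`; `C₀ ≥ 1`):

* `HierarchyModel.abs_blockComp_iterRem_le` — **the bound (4.17) on one term of the remainder**:
  for `i < K`, `|(blockComp i [Rem_i])^{(1)}(Z)| ≤ R₀ C₀ γ^{A^{i+1}}` as soon as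
  `C₀ c_R h ≤ γ/e²`, `γ ≤ 1`, where `c_R = HierarchyModel.pruneConst M β =
  4√2 · opConst · 2^{d/2} / β^{(d+1)/2}`;
* `HierarchyModel.abs_pruningRemainder_le` — **(4.14)**: `|∑_{i<K} (blockComp i [Rem_i])^{(1)}(Z)|
  ≤ 2 γ^A R₀ C₀` for `γ ≤ 1/2` under the same smallness of the step `h`;
* `HierarchyModel.IsMildSolution.abs_sub_blockComp_le` — the same bound for
  `F^{(1)}(Kh) - (blockComp K [F(0)])^{(1)}`, i.e. `f^{(1)} - f^{(1,K)}` of (4.9) for a two-time mild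
  solution (N4a `blockComp_spec`).

## The proof, and how it differs from the printed one

The printed proof (pp. 13–14) bounds the term `k` of `R_N^K` by
`‖|Q|_{1,J_{k-1}}((k-1)h) R_{J_{k-1},n_k}(t-kh, t-(k-1)h)‖_∞` ("the exact distribution of
collisions in the last `k-1` intervals is not needed"), which uses the POSITIVITY of the BBGKY and
Boltzmann collision kernels (the block-structured iterated time integral is dominated by the full
Duhamel majorant `|Q|` over the time span `(k-1)h ≤ t`); Lemma 4.2 then costs
`(C α t)^{J_{k-1}-1}` for the block part ((4.16)), whence the factor `t^{1/(A-1)}` in (4.13). An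
abstract `HierarchyModel` only knows its collision operators through the weighted estimate (4.5),
so positivity is not available; instead the weighted chain estimate of Lemma 4.2
(`abs_duhamelTerm_le_weighted`, `HierarchyModel.abs_iterRem_le_weighted`) is applied block by
block, from the remainder outwards, with the weight loss `β/2` of the printed proof distributed as
`β/4` on the `n_{i+1}` collisions of the remainder and `β/4 · 2^{-(i-b)}` on block `b < i`, and
with the particle-number bound of each block taken to be the number of particles that can actually
be present in that block (`pruneLevel`). Each block then costs a factor
`∑_{j<n_b} (C₀ Λ_b h)^j / j! ≤ exp(C₀ Λ_b h)` with `Λ_b ≤ c_R A^{b+1} 2^{(i-b)/2}`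
(`chainCost_le`), the blocks together `exp(3 c_R C₀ h A^{i+1})`, and the remainder
`(e c_R C₀ h)^{A^{i+1}}` (Stirling, `n^n/n! ≤ e^n`, exactly as in the printed (4.16)–(4.17)); the
term `i` is thus `≤ R₀ C₀ exp(A^{i+1} [1 + log(c_R C₀ h) + 3 c_R C₀ h]) ≤ R₀ C₀ γ^{A^{i+1}}`, and
(4.14) follows by summing the super-geometric series as printed. The outcome is the printed
conclusion (4.14) under the step condition `h ≤ γ / (e² c_R C₀)`, which does not involve `t`:
since `c_R` is proportional to `opConst ∝ α`, the printed condition (4.13) implies it whenever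
`α t ≥ 1` (up to the value of the unspecified constant `c`), so that, once the BBGKY and Boltzmann
families are known to be two-time mild solutions of `bbgkyModel`/`boltzmannModel` with the a priori
bounds (4.6)–(4.7) (not done here), the statements below yield the printed Proposition 4.3 in the
regime `t > 1`, `α > 1` of Theorem 2.2, in the form the proof of Theorem 2.2 (p. 21) consumes.
Nothing here is specific to hard spheres, to the torus or to `s = 1` data beyond what (4.5) and the
a priori bound express.

## Main definitions

* `pruneSeq A b = A^(b+1)` — the thresholds `n_{b+1}` (0-indexed blocks, outermost first).
* `pruneLevel A b = 1 + ∑_{b'<b} (n_{b'+1} - 1)` — the largest number of particles entering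
  block `b` (BGSR's `J_b ≤ 𝒩_b`); `pruneLevel_succ_le : pruneLevel A (b+1) ≤ 2 A^(b+1)`.
* `IsLevelBdd G L R C₀ w` — `|G^{(a)}(Z)| ≤ R C₀^a e^{-w H(Z)}` for all levels `a ≤ L` (the
  form in which the a priori bound propagates through the blocks).
* `HierarchyModel.chainCost M λₘ δ k` — the cost `Λ = opConst λₘ^{-d/2} (k λₘ^{-1/2} + (k/δ)^{1/2})`
  of one collision operator in the chain estimate of N3; `HierarchyModel.pruneConst M β = c_R`.

## References

* T. Bodineau, I. Gallagher, L. Saint-Raymond, *The Brownian motion as the limit of a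
  deterministic system of hard-spheres*, Invent. Math. 203 (2016) 493–553 = arXiv:1305.3397v2,
  §4.2–4.4, Lemma 4.2, Proposition 4.3, (4.5)–(4.17), pp. 11–14 of the held text
  (`lit read arxiv:1305.3397`). Equation numbers are those of the arXiv v2 TeX source: Lemma 4.2 is
  (4.3)–(4.4) with the single-step estimate (4.5) in its proof, the a priori bounds are (4.6)–(4.7),
  the pruned expansions (4.8)–(4.12), Proposition 4.3 is (4.13)–(4.14) and its proof uses
  (4.15)–(4.17) (the sibling files N3/N4a quote the single-step estimate as "(4.11)" and the
  expansions as "(4.4)–(4.7)").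
-/

open MeasureTheory Metric Real Set Filter Function
open scoped Nat
open Literature.Analysis.FluidPDE (Config configEnergy GCState)

namespace Literature.MathematicalPhysics.KineticTheory

noncomputable section

section Kinetic

variable {d : Type*} [Fintype d] {X : Type*}

/-! ## Thresholds `n_k = A^k` and the number of particles per block -/

section Thresholds

/-- BGSR's thresholds `n_k := A^k` (Prop. 4.3), indexed by the 0-based block number `b = k - 1`
used by `HierarchyModel.blockComp` (block `0` is the last time interval `[t - h, t]`):
`pruneSeq A b = A^(b+1)`. [cite: BodineauGallagherSaintRaymondInvent2016, §4.4 Prop. 4.3, p. 13] -/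
def pruneSeq (A : ℕ) (b : ℕ) : ℕ := A ^ (b + 1)

/-- Unfolding lemma for `pruneSeq`. [folklore] -/
@[simp]
theorem pruneSeq_apply (A b : ℕ) : pruneSeq A b = A ^ (b + 1) := rfl

/-- The thresholds are positive for `A ≥ 1`. [folklore] -/
theorem one_le_pruneSeq {A : ℕ} (hA : 1 ≤ A) (b : ℕ) : 1 ≤ pruneSeq A b :=
  Nat.one_le_pow _ _ hA

/-- The largest number of particles that can enter block `b` of the pruned expansion started
from one particle: `pruneLevel A b = 1 + ∑_{b'<b} (n_{b'+1} - 1)` (fewer than `n_{b'+1}`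
particles are created in block `b'`); BGSR's `J_b`, bounded by their `𝒩_b = 1 + n_1 + ⋯ + n_b`
(p. 13). [cite: BodineauGallagherSaintRaymondInvent2016, §4.4, p. 13] -/
def pruneLevel (A : ℕ) (b : ℕ) : ℕ := 1 + ∑ b' ∈ Finset.range b, (pruneSeq A b' - 1)

/-- No block: one particle. [folklore] -/
@[simp]
theorem pruneLevel_zero (A : ℕ) : pruneLevel A 0 = 1 := by simp [pruneLevel]

/-- One more block adds at most `n_{b+1} - 1` particles: `L_{b+1} + 1 = L_b + n_{b+1}`. [folklore] -/
theorem pruneLevel_succ {A : ℕ} (hA : 1 ≤ A) (b : ℕ) :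
    pruneLevel A (b + 1) + 1 = pruneLevel A b + pruneSeq A b := by
  have h1 := one_le_pruneSeq hA b
  simp only [pruneLevel, Finset.sum_range_succ]
  omega

/-- The levels increase along the blocks. [folklore] -/
theorem pruneLevel_le_succ {A : ℕ} (hA : 1 ≤ A) (b : ℕ) : pruneLevel A b ≤ pruneLevel A (b + 1) := by
  have := pruneLevel_succ hA b
  have h1 := one_le_pruneSeq hA b
  omega

/-- `1 ≤ L_b`. [folklore] -/
theorem one_le_pruneLevel (A b : ℕ) : 1 ≤ pruneLevel A b := by
  simp [pruneLevel]

/-- **`J_{b+1} ≤ 𝒩_{b+1} ≤ 2 n_{b+1}`**: after `b + 1` blocks at most `2 A^(b+1)` particles are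
present (`A ≥ 2`; BGSR p. 13: `𝒩_j ≤ n_{j+1}/(A-1)`). [cite: BodineauGallagherSaintRaymondInvent2016, §4.4, p. 13] -/
theorem pruneLevel_succ_le {A : ℕ} (hA : 2 ≤ A) : ∀ b : ℕ, pruneLevel A (b + 1) ≤ 2 * A ^ (b + 1) := by
  have hA1 : 1 ≤ A := by omega
  intro b
  induction b with
  | zero =>
    have := pruneLevel_succ hA1 0
    simp only [pruneLevel_zero, pruneSeq_apply, zero_add, pow_one] at this ⊢
    omega
  | succ b ih =>
    have h := pruneLevel_succ hA1 (b + 1)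
    simp only [pruneSeq_apply] at h
    have hpow : 2 * A ^ (b + 1) ≤ A ^ (b + 1 + 1) :=
      calc 2 * A ^ (b + 1) = A ^ (b + 1) * 2 := mul_comm _ _
        _ ≤ A ^ (b + 1) * A := Nat.mul_le_mul_left _ hA
        _ = A ^ (b + 1 + 1) := (pow_succ _ _).symm
    omega

/-- The level entering block `i` is at most the threshold of that block: `L_i ≤ n_{i+1} = A^(i+1)`
(`A ≥ 2`). [folklore] -/
theorem pruneLevel_le_pruneSeq {A : ℕ} (hA : 2 ≤ A) (i : ℕ) : pruneLevel A i ≤ pruneSeq A i := by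
  cases i with
  | zero => simp only [pruneLevel_zero, pruneSeq_apply, zero_add, pow_one]; omega
  | succ b =>
    have h := pruneLevel_succ_le hA b
    have hpow : 2 * A ^ (b + 1) ≤ A ^ (b + 1 + 1) :=
      calc 2 * A ^ (b + 1) = A ^ (b + 1) * 2 := mul_comm _ _
        _ ≤ A ^ (b + 1) * A := Nat.mul_le_mul_left _ hA
        _ = A ^ (b + 1 + 1) := (pow_succ _ _).symm
    simp only [pruneSeq_apply]
    omega

/-- `A^(i+1) ≥ A + i` for `A ≥ 2` (the thresholds are eventually far apart; used to sum the
super-geometric series `∑_i γ^{A^{i+1}} ≤ ∑_i γ^{A+i}`). [folklore] -/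
theorem add_le_pow_succ {A : ℕ} (hA : 2 ≤ A) : ∀ i : ℕ, A + i ≤ A ^ (i + 1) := by
  intro i
  induction i with
  | zero => simp
  | succ i ih =>
    have h1 : A ^ (i + 1 + 1) = A * A ^ (i + 1) := by ring
    rw [h1]
    nlinarith

/-- The geometric bookkeeping of the block costs: `∑_{b<i} A^(b+1) (√2)^(i-b) ≤ 6 A^i` for
`A ≥ 2` (ratio `√2/A < 1`; `√2 < 3/2`). [folklore] -/
theorem sum_pow_mul_sqrt_two_pow_le {A : ℕ} (hA : 2 ≤ A) :
    ∀ i : ℕ, ∑ b ∈ Finset.range i, (A : ℝ) ^ (b + 1) * sqrt 2 ^ (i - b) ≤ 6 * (A : ℝ) ^ i := by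
  have hA' : (2 : ℝ) ≤ A := by exact_mod_cast hA
  have hs2 : sqrt 2 < 3 / 2 := Real.sqrt_two_lt_three_halves
  have hs0 : 0 ≤ sqrt 2 := Real.sqrt_nonneg 2
  intro i
  induction i with
  | zero => simp
  | succ i ih =>
    -- `S_{i+1} = √2 S_i + √2 A^{i+1}`
    have hrew : ∑ b ∈ Finset.range (i + 1), (A : ℝ) ^ (b + 1) * sqrt 2 ^ (i + 1 - b) =
        sqrt 2 * ∑ b ∈ Finset.range i, (A : ℝ) ^ (b + 1) * sqrt 2 ^ (i - b) +
          (A : ℝ) ^ (i + 1) * sqrt 2 := by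
      rw [Finset.sum_range_succ, Finset.mul_sum]
      congr 1
      · refine Finset.sum_congr rfl fun b hb => ?_
        have hb' : b < i := Finset.mem_range.1 hb
        have : i + 1 - b = (i - b) + 1 := by omega
        rw [this, pow_succ]
        ring
      · simp
    rw [hrew]
    have hAi : (0 : ℝ) ≤ (A : ℝ) ^ i := by positivity
    calc sqrt 2 * ∑ b ∈ Finset.range i, (A : ℝ) ^ (b + 1) * sqrt 2 ^ (i - b) + (A : ℝ) ^ (i + 1) * sqrt 2
        ≤ sqrt 2 * (6 * (A : ℝ) ^ i) + (A : ℝ) ^ (i + 1) * sqrt 2 := by gcongr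
      _ ≤ 3 / 2 * (6 * (A : ℝ) ^ i) + (A : ℝ) ^ (i + 1) * (3 / 2) := by gcongr
      _ = (9 + 3 / 2 * A) * (A : ℝ) ^ i := by ring
      _ ≤ (6 * A) * (A : ℝ) ^ i := by gcongr; linarith
      _ = 6 * (A : ℝ) ^ (i + 1) := by ring

/-- Summation of the super-geometric series of (4.14): for `0 ≤ γ ≤ 1/2` and `A ≥ 2`,
`∑_{i<K} γ^{A^{i+1}} ≤ 2 γ^A`. [cite: BodineauGallagherSaintRaymondInvent2016, §4.4, p. 14] -/
theorem sum_pow_pruneSeq_le {A : ℕ} (hA : 2 ≤ A) {γ : ℝ} (hγ0 : 0 ≤ γ) (hγ : γ ≤ 1 / 2) (K : ℕ) :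
    ∑ i ∈ Finset.range K, γ ^ pruneSeq A i ≤ 2 * γ ^ A := by
  have hγ1 : γ ≤ 1 := hγ.trans (by norm_num)
  calc ∑ i ∈ Finset.range K, γ ^ pruneSeq A i ≤ ∑ i ∈ Finset.range K, γ ^ A * γ ^ i := by
        refine Finset.sum_le_sum fun i _ => ?_
        rw [← pow_add, pruneSeq_apply]
        exact pow_le_pow_of_le_one hγ0 hγ1 (add_le_pow_succ hA i)
    _ = γ ^ A * ∑ i ∈ Finset.range K, γ ^ i := by rw [Finset.mul_sum]
    _ ≤ γ ^ A * 2 := by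
        gcongr
        have hS := geom_sum_mul_neg γ K
        have h2 : (∑ i ∈ Finset.range K, γ ^ i) * (1 - γ) ≤ 1 := by
          rw [hS]; linarith [pow_nonneg hγ0 K]
        by_contra hc
        have hc' : 2 < ∑ i ∈ Finset.range K, γ ^ i := lt_of_not_ge hc
        have : 2 * (1 - γ) < (∑ i ∈ Finset.range K, γ ^ i) * (1 - γ) :=
          mul_lt_mul_of_pos_right hc' (by linarith)
        linarith
    _ = 2 * γ ^ A := by ring

end Thresholds

/-! ## Level-dependent Gaussian bounds and the cost of one collision operator -/

section Cost

/-- `G` is bounded by `R C₀^a e^{-w H}` at every level `a ≤ L`: the shape in which the a priori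
bound (4.6)/(4.7) `‖F^{(k)}‖_{k,β} ≤ C^k ‖ρ⁰‖` propagates through the blocks of the pruned
expansion. [cite: BodineauGallagherSaintRaymondInvent2016, §4.3 (4.6)-(4.7), p. 12] -/
def IsLevelBdd (G : GCState d X) (L : ℕ) (R C₀ w : ℝ) : Prop :=
  ∀ a ≤ L, ∀ Z : Config a d X, |G a Z| ≤ R * C₀ ^ a * exp (-w * configEnergy Z)

/-- Weakening of a level bound: fewer levels, larger constant, smaller weight. [folklore] -/
theorem IsLevelBdd.mono {G : GCState d X} {L L' : ℕ} {R R' C₀ w w' : ℝ} (h : IsLevelBdd G L R C₀ w)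
    (hL : L' ≤ L) (hR0 : 0 ≤ R) (hR : R ≤ R') (hC₀ : 0 ≤ C₀) (hw : w' ≤ w) :
    IsLevelBdd G L' R' C₀ w' := by
  intro a ha Z
  have hE : 0 ≤ configEnergy Z := configEnergy_nonneg' Z
  have hR' : 0 ≤ R' := hR0.trans hR
  calc |G a Z| ≤ R * C₀ ^ a * exp (-w * configEnergy Z) := h a (ha.trans hL) Z
    _ ≤ R' * C₀ ^ a * exp (-w * configEnergy Z) := by gcongr
    _ ≤ R' * C₀ ^ a * exp (-w' * configEnergy Z) := by
        have : 0 ≤ R' * C₀ ^ a := by positivity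
        gcongr R' * C₀ ^ a * ?_
        exact exp_le_exp.2 (by nlinarith)

variable [MeasurableSpace X]

namespace HierarchyModel

variable (M : HierarchyModel d X)

/-- The cost of one collision operator in the weighted chain estimate of BGSR Lemma 4.2
(`abs_duhamelChain_le_weighted`): `Λ(λₘ, δ, k) = opConst · λₘ^{-d/2} (k λₘ^{-1/2} + (k/δ)^{1/2})`
for a weight floor `λₘ`, a weight decrement `δ` per collision and at most `k` particles.
[cite: BodineauGallagherSaintRaymondInvent2016, §4.2 Lemma 4.2 (4.5), pp. 11–12] -/
def chainCost (bm δ : ℝ) (kmax : ℕ) : ℝ :=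
  M.opConst * (sqrt bm ^ Fintype.card d)⁻¹ * (kmax * (sqrt bm)⁻¹ + sqrt (kmax / δ))

/-- The cost is nonnegative. [folklore] -/
theorem chainCost_nonneg (bm δ : ℝ) (kmax : ℕ) : 0 ≤ M.chainCost bm δ kmax := by
  unfold chainCost
  have := M.opConst_nonneg
  have h1 : 0 ≤ (sqrt bm ^ Fintype.card d)⁻¹ := inv_nonneg.2 (pow_nonneg (sqrt_nonneg _) _)
  have h2 : 0 ≤ (kmax : ℝ) * (sqrt bm)⁻¹ := mul_nonneg (Nat.cast_nonneg _) (inv_nonneg.2 (sqrt_nonneg _))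
  positivity

/-- The cost is antitone in the decrement `δ`. [folklore] -/
theorem chainCost_mono_delta {bm δ δ' : ℝ} (hδ' : 0 < δ') (hle : δ' ≤ δ) (kmax : ℕ) :
    M.chainCost bm δ kmax ≤ M.chainCost bm δ' kmax := by
  unfold chainCost
  have := M.opConst_nonneg
  have h1 : 0 ≤ (sqrt bm ^ Fintype.card d)⁻¹ := inv_nonneg.2 (pow_nonneg (sqrt_nonneg _) _)
  have hk : (0 : ℝ) ≤ kmax := Nat.cast_nonneg _
  have hsq : sqrt (kmax / δ) ≤ sqrt (kmax / δ') :=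
    sqrt_le_sqrt (div_le_div_of_nonneg_left hk hδ' hle)
  gcongr

/-- The constant `c_R = 4√2 · opConst · 2^{d/2} / β^{(d+1)/2}` of the pruning estimate: with the
weight floor `β/2`, every collision operator of the term `i` of the remainder costs at most `c_R`
times the relevant particle number (`chainCost_le`). [cite: BodineauGallagherSaintRaymondInvent2016, §4.4 (4.16), p. 13] -/
def pruneConst (β : ℝ) : ℝ :=
  4 * sqrt 2 * M.opConst * sqrt 2 ^ Fintype.card d / sqrt β ^ (Fintype.card d + 1)

/-- `c_R ≥ 0`. [folklore] -/
theorem pruneConst_nonneg (β : ℝ) : 0 ≤ M.pruneConst β := by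
  unfold pruneConst
  have := M.opConst_nonneg
  positivity

/-- **The cost of one collision operator in the pruning estimate.** With floor `β/2`, at most
`2m` particles and a decrement `δ ≥ (β/4)/(m q²)` (`q ≥ 1`), `Λ ≤ c_R m q`: the remainder of the
term `i` is the case `m = n_{i+1}`, `q = 1`, and its block `b < i` the case `m = n_{b+1}`,
`q = 2^{(i-b)/2}` ("each collision operator gives a loss of `C λ^{-(d+1)/2} (s+n)`", BGSR p. 12,
with the particle numbers of p. 13). [cite: BodineauGallagherSaintRaymondInvent2016, §4.4 (4.16), p. 13] -/
theorem chainCost_le {β q δ : ℝ} (hβ : 0 < β) (hq : 1 ≤ q) {m : ℝ} (hm : 0 < m)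
    (hδ : β / 4 / (m * q ^ 2) ≤ δ) {kmax : ℕ} (hk : (kmax : ℝ) ≤ 2 * m) :
    M.chainCost (β / 2) δ kmax ≤ M.pruneConst β * m * q := by
  have hC := M.opConst_nonneg
  have hs2 : 0 < sqrt 2 := by positivity
  have hsβ : 0 < sqrt β := sqrt_pos.2 hβ
  have hq0 : 0 < q := by linarith
  have hk0 : (0 : ℝ) ≤ kmax := Nat.cast_nonneg _
  -- the floor
  have hhalf : sqrt (β / 2) = sqrt β / sqrt 2 := by rw [sqrt_div' _ zero_le_two]
  have hfloor : (sqrt (β / 2) ^ Fintype.card d)⁻¹ = sqrt 2 ^ Fintype.card d / sqrt β ^ Fintype.card d := by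
    rw [hhalf, div_pow, inv_div]
  -- the two summands
  have h1 : (kmax : ℝ) * (sqrt (β / 2))⁻¹ ≤ 2 * sqrt 2 * m * q / sqrt β := by
    rw [hhalf, inv_div]
    calc (kmax : ℝ) * (sqrt 2 / sqrt β) ≤ 2 * m * (sqrt 2 / sqrt β) := by gcongr
      _ = 2 * sqrt 2 * m * 1 / sqrt β := by ring
      _ ≤ 2 * sqrt 2 * m * q / sqrt β := by gcongr
  have h2 : sqrt (kmax / δ) ≤ 2 * sqrt 2 * m * q / sqrt β := by
    have hδ' : 0 < β / 4 / (m * q ^ 2) := by positivity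
    have hle : (kmax : ℝ) / δ ≤ 8 * (m * q) ^ 2 / β := by
      calc (kmax : ℝ) / δ ≤ kmax / (β / 4 / (m * q ^ 2)) := div_le_div_of_nonneg_left hk0 hδ' hδ
        _ = 4 * kmax * (m * q ^ 2) / β := by field_simp
        _ ≤ 4 * (2 * m) * (m * q ^ 2) / β := by gcongr
        _ = 8 * (m * q) ^ 2 / β := by ring
    calc sqrt (kmax / δ) ≤ sqrt (8 * (m * q) ^ 2 / β) := sqrt_le_sqrt hle
      _ = 2 * sqrt 2 * m * q / sqrt β := by
        have h8 : sqrt 8 = 2 * sqrt 2 := by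
          rw [show (8 : ℝ) = 2 ^ 2 * 2 by norm_num, sqrt_mul (by norm_num), sqrt_sq zero_le_two]
        rw [sqrt_div' _ hβ.le, sqrt_mul' _ (sq_nonneg _), sqrt_sq (by positivity), h8]
        ring
  unfold chainCost pruneConst
  rw [hfloor]
  calc M.opConst * (sqrt 2 ^ Fintype.card d / sqrt β ^ Fintype.card d) *
        ((kmax : ℝ) * (sqrt (β / 2))⁻¹ + sqrt (kmax / δ))
      ≤ M.opConst * (sqrt 2 ^ Fintype.card d / sqrt β ^ Fintype.card d) *
          (2 * sqrt 2 * m * q / sqrt β + 2 * sqrt 2 * m * q / sqrt β) := by gcongr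
    _ = 4 * sqrt 2 * M.opConst * sqrt 2 ^ Fintype.card d / sqrt β ^ (Fintype.card d + 1) * m * q := by
        rw [pow_succ]
        field_simp
        ring

end HierarchyModel

end Cost

/-! ## One block, and the composition of the blocks -/

section Blocks

variable [MeasurableSpace X] (M : HierarchyModel d X)

namespace HierarchyModel

/-- The budget of the blocks: `∑_{b<i} 2^{-(i-b)} ≤ 1`. [folklore] -/
theorem sum_half_pow_le : ∀ i : ℕ, ∑ b ∈ Finset.range i, (1 / 2 : ℝ) ^ (i - b) ≤ 1 := by
  intro i
  induction i with
  | zero => simp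
  | succ i ih =>
    have hrew : ∑ b ∈ Finset.range (i + 1), (1 / 2 : ℝ) ^ (i + 1 - b) =
        1 / 2 * ∑ b ∈ Finset.range i, (1 / 2 : ℝ) ^ (i - b) + 1 / 2 := by
      rw [Finset.sum_range_succ, Finset.mul_sum]
      congr 1
      · refine Finset.sum_congr rfl fun b hb => ?_
        have hb' : b < i := Finset.mem_range.1 hb
        have : i + 1 - b = (i - b) + 1 := by omega
        rw [this, pow_succ]
        ring
      · simp
    rw [hrew]
    linarith

/-- **One block of the pruned expansion propagates level bounds** (the chain estimate of BGSR
Lemma 4.2, `abs_duhamelTerm_le_weighted`, applied to each of the `< n` Duhamel terms of the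
block): if `|G^{(a)}| ≤ R C₀^a e^{-w H}` for `a ≤ L_top`, then for `a ≤ L_low`, `L_low + n ≤ L_top + 1`,
`|(blockOp n h G)^{(a)}| ≤ R (∑_{j<n} (C₀ Λ h)^j / j!) C₀^a e^{-(w - β_b) H}`,
`Λ = chainCost λₘ (β_b/n) L_top`: each of the `j < n` collision operators costs `Λ` and the weight
`β_b/n`, the level `a + j` of the datum costs `C₀^j`, the ordered time integrals give `h^j/j!`.
[cite: BodineauGallagherSaintRaymondInvent2016, §4.4 (4.16), p. 13] -/
theorem isLevelBdd_blockOp {G : GCState d X} {Ltop Llow n : ℕ} {R C₀ w βb bm : ℝ}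
    (hR : 0 ≤ R) (hC₀ : 1 ≤ C₀) (hbm : 0 < bm) (hβb : 0 < βb) (hw : bm + βb ≤ w)
    (hn : 1 ≤ n) (hL : Llow + n ≤ Ltop + 1) (hG : IsLevelBdd G Ltop R C₀ w) {h : ℝ} (hh : 0 ≤ h) :
    IsLevelBdd (M.blockOp n h G) Llow
      (R * ∑ j ∈ Finset.range n, (C₀ * M.chainCost bm (βb / n) Ltop * h) ^ j / j !) C₀ (w - βb) := by
  intro a ha Z
  set Λ := M.chainCost bm (βb / n) Ltop with hΛ
  have hC₀0 : 0 ≤ C₀ := zero_le_one.trans hC₀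
  have hn0 : (0 : ℝ) < n := by exact_mod_cast hn
  have hδ : 0 < βb / n := div_pos hβb hn0
  have hb₀ : bm ≤ w - βb := by linarith
  rw [M.blockOp_apply]
  refine (Finset.abs_sum_le_sum_abs _ _).trans ?_
  rw [Finset.mul_sum, Finset.sum_mul, Finset.sum_mul]
  refine Finset.sum_le_sum fun j hj => ?_
  have hjn : j < n := Finset.mem_range.1 hj
  have haj : a + j ≤ Ltop + 1 := by omega
  have hK : 0 ≤ R * C₀ ^ (a + j) := by positivity
  -- the datum at level `a + j`, its weight weakened from `w` to `(w - β_b) + j β_b/n ≤ w`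
  have hin : ∀ Z' : Config (a + j) d X, |G (a + j) Z'| ≤
      R * C₀ ^ (a + j) * exp (-((w - βb) + j * (βb / n)) * configEnergy Z') := by
    intro Z'
    refine (hG (a + j) (by omega) Z').trans ?_
    have hE : 0 ≤ configEnergy Z' := configEnergy_nonneg' Z'
    have hwle : (w - βb) + j * (βb / n) ≤ w := by
      have hj' : (j : ℝ) ≤ n := by exact_mod_cast hjn.le
      have : (j : ℝ) * (βb / n) ≤ βb := by
        rw [mul_div_assoc', div_le_iff₀ hn0]
        nlinarith
      linarith
    gcongr R * C₀ ^ (a + j) * ?_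
    exact exp_le_exp.2 (by nlinarith)
  have hest := abs_duhamelTerm_le_weighted M.transport_energy M.opConst_nonneg M.op_weighted hbm hδ
    Ltop j a haj hb₀ hK G hin hh Z
  refine hest.trans (le_of_eq ?_)
  change R * C₀ ^ (a + j) * Λ ^ j * h ^ j / j ! * exp (-(w - βb) * configEnergy Z) = _
  rw [pow_add, mul_pow, mul_pow]
  ring

/-- **Composition of the blocks.** For thresholds `n_{b+1} = A^(b+1)`, a weight floor `λₘ`,
budgets `β_b > 0` with `λₘ + ∑_{b<i} β_b ≤ w`, and a family `G` with `|G^{(a)}| ≤ R C₀^a e^{-w H}`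
at all levels `a ≤ L_i = pruneLevel A i`, the `i` outermost blocks satisfy
`|(blockComp i G)^{(1)}(Z)| ≤ R C₀ ∏_{b<i} ∑_{j<n_{b+1}} (C₀ Λ_b h)^j / j!`,
`Λ_b = chainCost λₘ (β_b/n_{b+1}) L_{b+1}` (induction on `i` with `isLevelBdd_blockOp`: block `b`
acts between the levels `L_b` and `L_{b+1}`; the final weight `≥ λₘ > 0` is dropped).
[cite: BodineauGallagherSaintRaymondInvent2016, §4.4 (4.16)-(4.17), pp. 13–14] -/
theorem abs_blockComp_le {A : ℕ} (hA : 1 ≤ A) {bm C₀ : ℝ} (hbm : 0 < bm) (hC₀ : 1 ≤ C₀)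
    (βs : ℕ → ℝ) (hβs : ∀ b, 0 < βs b) {h : ℝ} (hh : 0 ≤ h) :
    ∀ (i : ℕ) (G : GCState d X) (R w : ℝ), 0 ≤ R → bm + ∑ b ∈ Finset.range i, βs b ≤ w →
      IsLevelBdd G (pruneLevel A i) R C₀ w →
      ∀ Z : Config 1 d X, |M.blockComp (pruneSeq A) h i G 1 Z| ≤
        R * C₀ * ∏ b ∈ Finset.range i, ∑ j ∈ Finset.range (pruneSeq A b),
          (C₀ * M.chainCost bm (βs b / pruneSeq A b) (pruneLevel A (b + 1)) * h) ^ j / j ! := by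
  have hC₀0 : 0 ≤ C₀ := zero_le_one.trans hC₀
  intro i
  induction i with
  | zero =>
    intro G R w hR hw hG Z
    simp only [blockComp_zero, Finset.range_zero, Finset.prod_empty, mul_one]
    have hw0 : 0 ≤ w := by
      simp only [Finset.range_zero, Finset.sum_empty, add_zero] at hw
      linarith
    have hE := configEnergy_nonneg' Z
    calc |G 1 Z| ≤ R * C₀ ^ 1 * exp (-w * configEnergy Z) := hG 1 (by simp) Z
      _ ≤ R * C₀ ^ 1 * 1 := by
          have : 0 ≤ R * C₀ ^ 1 := by positivity
          gcongr R * C₀ ^ 1 * ?_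
          exact exp_le_one_iff.2 (by nlinarith)
      _ = R * C₀ := by ring
  | succ i ih =>
    intro G R w hR hw hG Z
    rw [blockComp_succ]
    have hsum0 : 0 ≤ ∑ b ∈ Finset.range i, βs b := Finset.sum_nonneg fun b _ => (hβs b).le
    rw [Finset.sum_range_succ] at hw
    have hL : pruneLevel A i + pruneSeq A i ≤ pruneLevel A (i + 1) + 1 := (pruneLevel_succ hA i).symm.le
    have hwb : bm + βs i ≤ w := by linarith
    have hG' := M.isLevelBdd_blockOp hR hC₀ hbm (hβs i) hwb (one_le_pruneSeq hA i) hL hG hh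
    have hR' : 0 ≤ R * ∑ j ∈ Finset.range (pruneSeq A i),
        (C₀ * M.chainCost bm (βs i / pruneSeq A i) (pruneLevel A (i + 1)) * h) ^ j / j ! := by
      refine mul_nonneg hR (Finset.sum_nonneg fun j _ => ?_)
      have := M.chainCost_nonneg bm (βs i / pruneSeq A i) (pruneLevel A (i + 1))
      positivity
    have hw' : bm + ∑ b ∈ Finset.range i, βs b ≤ w - βs i := by linarith
    refine (ih _ _ _ hR' hw' hG' Z).trans (le_of_eq ?_)
    rw [Finset.prod_range_succ]
    ring

/-! ## The remainder of one block -/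

/-- **The innermost slot: the remainder `R_{J,n}(t', t'+h)` of a block** (BGSR (4.16), via the
chain estimate `abs_iterRem_le_weighted` of N4a): under the a priori bound
`|F^{(k)}(τ)| ≤ R₀ C₀^k e^{-β H}` on `[0, T]`, for `0 ≤ t' ≤ T`, `h ∈ [0, T - t']`, `n ≥ 1`, at
every level `a ≤ L`,
`|iterRem M F t' n a h (Z)| ≤ R₀ C₀^a (C₀ Λ h)^n / n! · e^{-(3β/4) H(Z)}`,
`Λ = chainCost (β/2) ((β/4)/n) (L + n)` (floor `β/2`, decrement `β/4n` on each of the `n`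
collision operators, at most `L + n` particles).
[cite: BodineauGallagherSaintRaymondInvent2016, §4.4 (4.16), p. 13] -/
theorem isLevelBdd_iterRem {F : (s : ℕ) → ℝ → Config s d X → ℝ} {T t' : ℝ} (ht'0 : 0 ≤ t')
    (ht'T : t' ≤ T) {R₀ C₀ β : ℝ} (hR₀ : 0 ≤ R₀) (hC₀ : 1 ≤ C₀) (hβ : 0 < β)
    (hFb : ∀ (k : ℕ), ∀ τ ∈ Icc 0 T, ∀ Z : Config k d X,
      |F k τ Z| ≤ R₀ * C₀ ^ k * exp (-β * configEnergy Z))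
    (L : ℕ) {n : ℕ} (hn : 1 ≤ n) {h : ℝ} (hh : h ∈ Icc 0 (T - t')) :
    IsLevelBdd (fun a Z => M.iterRem F t' n a h Z) L
      (R₀ * ((C₀ * M.chainCost (β / 2) (β / 4 / n) (L + n) * h) ^ n / n !)) C₀ (3 * β / 4) := by
  intro a ha Z
  have hC₀0 : 0 ≤ C₀ := zero_le_one.trans hC₀
  have hn0 : (0 : ℝ) < n := by exact_mod_cast hn
  have hδ : 0 < β / 4 / n := by positivity
  have hbm : 0 < β / 2 := by positivity
  have hb₀ : β / 2 ≤ 3 * β / 4 := by linarith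
  have hK : 0 ≤ R₀ * C₀ ^ (a + n) := by positivity
  have hin : ∀ τ ∈ Icc 0 (T - t'), ∀ Z' : Config (a + n) d X, |F (a + n) (t' + τ) Z'| ≤
      R₀ * C₀ ^ (a + n) * exp (-(3 * β / 4 + n * (β / 4 / n)) * configEnergy Z') := by
    intro τ hτ Z'
    have hw : 3 * β / 4 + n * (β / 4 / n) = β := by
      field_simp
      ring
    rw [hw]
    exact hFb (a + n) (t' + τ) ⟨by linarith [hτ.1], by linarith [hτ.2]⟩ Z'
  have hest := M.abs_iterRem_le_weighted F ht'T hbm hδ (L + n) n a (by omega) hb₀ hK hin hh Z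
  refine hest.trans (le_of_eq ?_)
  change R₀ * C₀ ^ (a + n) * M.chainCost (β / 2) (β / 4 / n) (L + n) ^ n * h ^ n / n ! *
      exp (-(3 * β / 4) * configEnergy Z) = _
  rw [pow_add, mul_pow, mul_pow]
  ring

end HierarchyModel

end Blocks

/-! ## BGSR Proposition 4.3 -/

section Pruning

variable [MeasurableSpace X] (M : HierarchyModel d X)

namespace HierarchyModel

/-- The smallness mechanism of (4.17): if `x ≤ γ/e²` and `γ ≤ 1` then `e · x · e^{3x} ≤ γ`
(`3x ≤ 3γ/e² ≤ γ ≤ 1` since `3 ≤ e²`). [folklore] -/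
theorem exp_one_mul_mul_exp_le {x γ : ℝ} (hx : 0 ≤ x) (hxγ : x ≤ γ / exp 2) (hγ1 : γ ≤ 1) :
    exp 1 * x * exp (3 * x) ≤ γ := by
  have he2 : 3 ≤ exp 2 := by
    have := Real.add_one_le_exp (2 : ℝ)
    linarith
  have he2pos : 0 < exp 2 := exp_pos 2
  have hγ0 : 0 ≤ γ := by
    have : 0 ≤ γ / exp 2 := hx.trans hxγ
    exact (div_nonneg_iff.1 this).elim (fun h => h.1) fun h => absurd h.2 (not_le.2 he2pos)
  have h3x : 3 * x ≤ 1 := by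
    have h1 : 3 * x ≤ 3 * (γ / exp 2) := by linarith
    have h2 : 3 * (γ / exp 2) ≤ γ := by
      rw [mul_div_assoc', div_le_iff₀ he2pos]
      nlinarith
    linarith
  calc exp 1 * x * exp (3 * x) ≤ exp 1 * (γ / exp 2) * exp 1 := by
        gcongr
    _ = γ := by
        have : exp 2 = exp 1 * exp 1 := by rw [← exp_add]; norm_num
        rw [this]
        field_simp

/-- **One term of the remainder (BGSR (4.16)–(4.17)).** Let `F` obey the a priori bound
`|F^{(k)}(τ, Z)| ≤ R₀ C₀^k e^{-β H_k(Z)}` on `[0, T]` (BGSR (4.6)/(4.7), `R₀ = ‖ρ⁰‖_∞`,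
`C₀ ≥ 1`), let `A ≥ 2`, `n_k = A^k`, `γ ≤ 1`, and let the step `h ≥ 0` satisfy
`C₀ c_R h ≤ γ / e²` (`c_R = pruneConst M β`). Then for every `i` with `t - (i+1)h ≥ 0`, `t ≤ T`,
the term `i` of the remainder of the pruned expansion — `i` blocks of fewer than `n_1, …, n_i`
collisions followed by `n_{i+1}` collisions in the block `[t-(i+1)h, t-ih]` — satisfies
`|(blockComp i [iterRem M F (t-(i+1)h) n_{i+1}])^{(1)}(Z)| ≤ R₀ C₀ γ^{A^{i+1}}`
(printed: `β^{d/2} exp(A^k log γ) ‖ρ⁰‖_∞`). Proof: `isLevelBdd_iterRem` (remainder: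
`(e C₀ c_R h)^{n_{i+1}}` by `chainCost_le` and `n^n/n! ≤ e^n`), `abs_blockComp_le` with the budgets
`β_b = (β/4) 2^{-(i-b)}` (blocks: `∏_b exp(C₀ Λ_b h) ≤ exp(6 C₀ c_R h A^i) ≤ exp(3 C₀ c_R h A^{i+1})`
by `chainCost_le`, `sum_pow_mul_sqrt_two_pow_le`), and `exp_one_mul_mul_exp_le`.
[cite: BodineauGallagherSaintRaymondInvent2016, §4.4 Prop. 4.3 (4.16)-(4.17), pp. 13–14] -/
theorem abs_blockComp_iterRem_le {F : (s : ℕ) → ℝ → Config s d X → ℝ} {T : ℝ} {R₀ C₀ β : ℝ}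
    (hR₀ : 0 ≤ R₀) (hC₀ : 1 ≤ C₀) (hβ : 0 < β)
    (hFb : ∀ (k : ℕ), ∀ τ ∈ Icc 0 T, ∀ Z : Config k d X,
      |F k τ Z| ≤ R₀ * C₀ ^ k * exp (-β * configEnergy Z))
    {A : ℕ} (hA : 2 ≤ A) {γ : ℝ} (hγ1 : γ ≤ 1) {h : ℝ} (hh0 : 0 ≤ h)
    (hsmall : C₀ * M.pruneConst β * h ≤ γ / exp 2) {t : ℝ} (htT : t ≤ T) (i : ℕ)
    (hi : 0 ≤ t - (i + 1) * h) (Z : Config 1 d X) :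
    |M.blockComp (pruneSeq A) h i (fun a Z => M.iterRem F (t - (i + 1) * h) (pruneSeq A i) a h Z) 1 Z| ≤
      R₀ * C₀ * γ ^ pruneSeq A i := by
  have hA1 : 1 ≤ A := by omega
  have hC₀0 : 0 ≤ C₀ := zero_le_one.trans hC₀
  have hcR := M.pruneConst_nonneg β
  set n := pruneSeq A i with hn_def
  set x := C₀ * M.pruneConst β * h with hx
  have hx0 : 0 ≤ x := by positivity
  have hn1 : 1 ≤ n := one_le_pruneSeq hA1 i
  have hn0 : (0 : ℝ) < n := by exact_mod_cast hn1
  have hnA : (n : ℝ) = (A : ℝ) ^ (i + 1) := by rw [hn_def, pruneSeq_apply]; push_cast; ring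
  -- the remainder of block `i`
  have ht'T : t - (i + 1) * h ≤ T := by nlinarith
  have hhI : h ∈ Icc 0 (T - (t - (i + 1) * h)) := ⟨hh0, by nlinarith⟩
  have hrem := M.isLevelBdd_iterRem hi ht'T hR₀ hC₀ hβ hFb (pruneLevel A i) hn1 hhI
  -- the blocks, with budgets `β_b = (β/4) 2^{-(i-b)}`
  set βs : ℕ → ℝ := fun b => β / 4 / 2 ^ (i - b) with hβs
  have hβs0 : ∀ b, 0 < βs b := fun b => by positivity
  have hbudget : β / 2 + ∑ b ∈ Finset.range i, βs b ≤ 3 * β / 4 := by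
    have hsum : ∑ b ∈ Finset.range i, βs b = β / 4 * ∑ b ∈ Finset.range i, (1 / 2 : ℝ) ^ (i - b) := by
      rw [Finset.mul_sum]
      refine Finset.sum_congr rfl fun b _ => ?_
      show β / 4 / 2 ^ (i - b) = β / 4 * (1 / 2) ^ (i - b)
      rw [one_div, inv_pow, div_eq_mul_inv]
    rw [hsum]
    nlinarith [sum_half_pow_le i, hβ]
  have hRrem : 0 ≤ R₀ * ((C₀ * M.chainCost (β / 2) (β / 4 / n) (pruneLevel A i + n) * h) ^ n / n !) := by
    have := M.chainCost_nonneg (β / 2) (β / 4 / n) (pruneLevel A i + n)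
    positivity
  have hblk := M.abs_blockComp_le hA1 (half_pos hβ) hC₀ βs hβs0 hh0 i _ _ _ hRrem hbudget hrem Z
  refine hblk.trans ?_
  -- (a) the remainder factor: `(C₀ Λ_r h)^n / n! ≤ (e x)^n`
  have hΛr : M.chainCost (β / 2) (β / 4 / n) (pruneLevel A i + n) ≤ M.pruneConst β * n * 1 := by
    refine M.chainCost_le hβ le_rfl hn0 (by simp) ?_
    have := pruneLevel_le_pruneSeq hA i
    push_cast
    have : ((pruneLevel A i : ℕ) : ℝ) ≤ n := by exact_mod_cast this
    linarith
  have hrem_le : (C₀ * M.chainCost (β / 2) (β / 4 / n) (pruneLevel A i + n) * h) ^ n / n ! ≤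
      (exp 1 * x) ^ n := by
    have h1 : C₀ * M.chainCost (β / 2) (β / 4 / n) (pruneLevel A i + n) * h ≤ x * n := by
      calc C₀ * M.chainCost (β / 2) (β / 4 / n) (pruneLevel A i + n) * h
          ≤ C₀ * (M.pruneConst β * n * 1) * h := by gcongr
        _ = x * n := by rw [hx]; ring
    have h0 : 0 ≤ C₀ * M.chainCost (β / 2) (β / 4 / n) (pruneLevel A i + n) * h := by
      have := M.chainCost_nonneg (β / 2) (β / 4 / n) (pruneLevel A i + n)
      positivity
    have hst : (n : ℝ) ^ n / n ! ≤ exp 1 ^ n := by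
      have := Real.pow_div_factorial_le_exp (x := (n : ℝ)) (Nat.cast_nonneg n) n
      rwa [← Real.exp_one_pow] at this
    calc (C₀ * M.chainCost (β / 2) (β / 4 / n) (pruneLevel A i + n) * h) ^ n / n !
        ≤ (x * n) ^ n / n ! := by gcongr
      _ = x ^ n * ((n : ℝ) ^ n / n !) := by rw [mul_pow]; ring
      _ ≤ x ^ n * exp 1 ^ n := by gcongr
      _ = (exp 1 * x) ^ n := by rw [mul_pow]; ring
  -- (b) the block factors: `∑_{j<n_b} (C₀ Λ_b h)^j/j! ≤ exp(x n_b √2^{i-b})`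
  have hblock_le : ∀ b ∈ Finset.range i, ∑ j ∈ Finset.range (pruneSeq A b),
      (C₀ * M.chainCost (β / 2) (βs b / pruneSeq A b) (pruneLevel A (b + 1)) * h) ^ j / j ! ≤
        exp (x * ((A : ℝ) ^ (b + 1) * sqrt 2 ^ (i - b))) := by
    intro b hb
    have hnb : (0 : ℝ) < pruneSeq A b := by exact_mod_cast one_le_pruneSeq hA1 b
    have hq : (1 : ℝ) ≤ sqrt 2 ^ (i - b) := one_le_pow₀ Real.one_lt_sqrt_two.le
    have hΛb : M.chainCost (β / 2) (βs b / pruneSeq A b) (pruneLevel A (b + 1)) ≤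
        M.pruneConst β * pruneSeq A b * sqrt 2 ^ (i - b) := by
      refine M.chainCost_le hβ hq hnb (le_of_eq ?_) ?_
      · show β / 4 / (pruneSeq A b * (sqrt 2 ^ (i - b)) ^ 2) = β / 4 / 2 ^ (i - b) / pruneSeq A b
        rw [← pow_mul, mul_comm (i - b) 2, pow_mul, sq_sqrt zero_le_two]
        field_simp
      · have := pruneLevel_succ_le hA b
        have h' : ((pruneLevel A (b + 1) : ℕ) : ℝ) ≤ ((2 * A ^ (b + 1) : ℕ) : ℝ) := by exact_mod_cast this
        simpa [pruneSeq_apply] using h'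
    have h0 : 0 ≤ C₀ * M.chainCost (β / 2) (βs b / pruneSeq A b) (pruneLevel A (b + 1)) * h := by
      have := M.chainCost_nonneg (β / 2) (βs b / pruneSeq A b) (pruneLevel A (b + 1))
      positivity
    refine (Real.sum_le_exp_of_nonneg h0 _).trans (exp_le_exp.2 ?_)
    calc C₀ * M.chainCost (β / 2) (βs b / pruneSeq A b) (pruneLevel A (b + 1)) * h
        ≤ C₀ * (M.pruneConst β * pruneSeq A b * sqrt 2 ^ (i - b)) * h := by gcongr
      _ = x * ((A : ℝ) ^ (b + 1) * sqrt 2 ^ (i - b)) := by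
          rw [hx, pruneSeq_apply]; push_cast; ring
  have hprod_le : ∏ b ∈ Finset.range i, ∑ j ∈ Finset.range (pruneSeq A b),
      (C₀ * M.chainCost (β / 2) (βs b / pruneSeq A b) (pruneLevel A (b + 1)) * h) ^ j / j ! ≤
        exp (3 * x * n) := by
    calc ∏ b ∈ Finset.range i, ∑ j ∈ Finset.range (pruneSeq A b),
          (C₀ * M.chainCost (β / 2) (βs b / pruneSeq A b) (pruneLevel A (b + 1)) * h) ^ j / j !
        ≤ ∏ b ∈ Finset.range i, exp (x * ((A : ℝ) ^ (b + 1) * sqrt 2 ^ (i - b))) := by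
          refine Finset.prod_le_prod (fun b _ => Finset.sum_nonneg fun j _ => ?_) hblock_le
          have := M.chainCost_nonneg (β / 2) (βs b / pruneSeq A b) (pruneLevel A (b + 1))
          positivity
      _ = exp (x * ∑ b ∈ Finset.range i, (A : ℝ) ^ (b + 1) * sqrt 2 ^ (i - b)) := by
          rw [Finset.mul_sum, Real.exp_sum]
      _ ≤ exp (3 * x * n) := by
          refine exp_le_exp.2 ?_
          have hs := sum_pow_mul_sqrt_two_pow_le hA i
          have hA2 : (2 : ℝ) ≤ A := by exact_mod_cast hA
          have hAi : (0 : ℝ) ≤ (A : ℝ) ^ i := by positivity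
          calc x * ∑ b ∈ Finset.range i, (A : ℝ) ^ (b + 1) * sqrt 2 ^ (i - b) ≤ x * (6 * (A : ℝ) ^ i) :=
                mul_le_mul_of_nonneg_left hs hx0
            _ ≤ x * (3 * (A : ℝ) ^ (i + 1)) := by
                refine mul_le_mul_of_nonneg_left ?_ hx0
                rw [pow_succ]
                nlinarith
            _ = 3 * x * n := by rw [hnA]; ring
  -- (c) combine
  have hkey : exp 1 * x * exp (3 * x) ≤ γ := exp_one_mul_mul_exp_le hx0 hsmall hγ1
  have hkey0 : 0 ≤ exp 1 * x * exp (3 * x) := by positivity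
  have hprod0 : 0 ≤ ∏ b ∈ Finset.range i, ∑ j ∈ Finset.range (pruneSeq A b),
      (C₀ * M.chainCost (β / 2) (βs b / pruneSeq A b) (pruneLevel A (b + 1)) * h) ^ j / j ! := by
    refine Finset.prod_nonneg fun b _ => Finset.sum_nonneg fun j _ => ?_
    have := M.chainCost_nonneg (β / 2) (βs b / pruneSeq A b) (pruneLevel A (b + 1))
    positivity
  calc R₀ * ((C₀ * M.chainCost (β / 2) (β / 4 / n) (pruneLevel A i + n) * h) ^ n / n !) * C₀ *
        ∏ b ∈ Finset.range i, ∑ j ∈ Finset.range (pruneSeq A b),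
          (C₀ * M.chainCost (β / 2) (βs b / pruneSeq A b) (pruneLevel A (b + 1)) * h) ^ j / j !
      ≤ R₀ * (exp 1 * x) ^ n * C₀ * exp (3 * x * n) := by gcongr
    _ = R₀ * C₀ * (exp 1 * x * exp (3 * x)) ^ n := by
        rw [mul_pow, show 3 * x * n = (n : ℝ) * (3 * x) by ring, Real.exp_nat_mul]
        ring
    _ ≤ R₀ * C₀ * γ ^ n := by gcongr

/-- **BGSR Proposition 4.3, (4.14): the remainder of the pruned expansion is `O(γ^A)`.** For an
abstract hierarchy `M` and a family `F` with `|F^{(k)}(τ, Z)| ≤ R₀ C₀^k e^{-β H(Z)}` on `[0, T]`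
(the a priori bounds (4.6)/(4.7)), thresholds `n_k = A^k` (`A ≥ 2`), `0 ≤ γ ≤ 1/2`, `K` blocks
of duration `h` with `Kh ≤ T` and a step so small that `C₀ c_R h ≤ γ/e²`, the remainder
`R^K = ∑_{i<K} (blockComp i [Rem_i])^{(1)}` of the expansion (4.9) (N4a `blockComp_spec`,
`Rem_i = iterRem M F (Kh - (i+1)h) n_{i+1}`) satisfies `|R^K(Z)| ≤ 2 γ^A R₀ C₀` for every
one-particle configuration `Z` (printed: `≤ C γ^A ‖ρ⁰‖_{L^∞}` under (4.13); see the module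
docstring for the comparison of the step conditions: `c_R ∝ opConst ∝ α`, no factor
`t^{1/(A-1)}`). [cite: BodineauGallagherSaintRaymondInvent2016, §4.4 Prop. 4.3 (4.13)-(4.14), p. 13] -/
theorem abs_pruningRemainder_le {F : (s : ℕ) → ℝ → Config s d X → ℝ} {T : ℝ} {R₀ C₀ β : ℝ}
    (hR₀ : 0 ≤ R₀) (hC₀ : 1 ≤ C₀) (hβ : 0 < β)
    (hFb : ∀ (k : ℕ), ∀ τ ∈ Icc 0 T, ∀ Z : Config k d X,
      |F k τ Z| ≤ R₀ * C₀ ^ k * exp (-β * configEnergy Z))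
    {A : ℕ} (hA : 2 ≤ A) {γ : ℝ} (hγ0 : 0 ≤ γ) (hγ : γ ≤ 1 / 2) {h : ℝ} (hh0 : 0 ≤ h)
    (hsmall : C₀ * M.pruneConst β * h ≤ γ / exp 2) (K : ℕ) (hKT : K * h ≤ T) (Z : Config 1 d X) :
    |∑ i ∈ Finset.range K, M.blockComp (pruneSeq A) h i
        (fun a Z => M.iterRem F (K * h - (i + 1) * h) (pruneSeq A i) a h Z) 1 Z| ≤
      2 * γ ^ A * R₀ * C₀ := by
  have hC₀0 : 0 ≤ C₀ := zero_le_one.trans hC₀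
  have hγ1 : γ ≤ 1 := hγ.trans (by norm_num)
  refine (Finset.abs_sum_le_sum_abs _ _).trans ?_
  calc ∑ i ∈ Finset.range K, |M.blockComp (pruneSeq A) h i
          (fun a Z => M.iterRem F (K * h - (i + 1) * h) (pruneSeq A i) a h Z) 1 Z|
      ≤ ∑ i ∈ Finset.range K, R₀ * C₀ * γ ^ pruneSeq A i := by
        refine Finset.sum_le_sum fun i hi => ?_
        have hiK : i < K := Finset.mem_range.1 hi
        refine M.abs_blockComp_iterRem_le hR₀ hC₀ hβ hFb hA hγ1 hh0 hsmall hKT i ?_ Z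
        have : (i + 1 : ℝ) ≤ K := by exact_mod_cast hiK
        nlinarith
    _ = R₀ * C₀ * ∑ i ∈ Finset.range K, γ ^ pruneSeq A i := by rw [Finset.mul_sum]
    _ ≤ R₀ * C₀ * (2 * γ ^ A) := by
        have := sum_pow_pruneSeq_le hA hγ0 hγ K
        have h0 : 0 ≤ R₀ * C₀ := by positivity
        exact mul_le_mul_of_nonneg_left this h0
    _ = 2 * γ ^ A * R₀ * C₀ := by ring

/-- **BGSR Proposition 4.3 for a two-time mild solution: `f^{(1)} - f^{(1,K)}` is `O(γ^A)`.**
If moreover `F` is a two-time mild solution of `M` on `[0, T]` (N4a `IsMildSolution`), then by the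
block expansion (4.9) (`blockComp_spec` with `t = Kh`) the first marginal at time `t = Kh` differs
from the main term `f^{(1,K)}(t) = (blockComp K [F(0)])^{(1)}` ((4.10), nested form) by at most
`2 γ^A R₀ C₀`: this is the form in which Prop. 4.3 enters the proof of Theorem 2.2 (p. 21), for
both the BBGKY family (`R_N^K`) and the Boltzmann family (`R_α^{0,K}`).
[cite: BodineauGallagherSaintRaymondInvent2016, §4.4 Prop. 4.3 (4.14), p. 13] -/
theorem IsMildSolution.abs_sub_blockComp_le {F : (s : ℕ) → ℝ → Config s d X → ℝ} {T : ℝ}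
    (hF : M.IsMildSolution T F) {R₀ C₀ β : ℝ} (hR₀ : 0 ≤ R₀) (hC₀ : 1 ≤ C₀) (hβ : 0 < β)
    (hFb : ∀ (k : ℕ), ∀ τ ∈ Icc 0 T, ∀ Z : Config k d X,
      |F k τ Z| ≤ R₀ * C₀ ^ k * exp (-β * configEnergy Z))
    {A : ℕ} (hA : 2 ≤ A) {γ : ℝ} (hγ0 : 0 ≤ γ) (hγ : γ ≤ 1 / 2) {h : ℝ} (hh0 : 0 ≤ h)
    (hsmall : C₀ * M.pruneConst β * h ≤ γ / exp 2) (K : ℕ) (hKT : K * h ≤ T) (Z : Config 1 d X) :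
    |F 1 (K * h) Z - M.blockComp (pruneSeq A) h K (fun a => F a 0) 1 Z| ≤ 2 * γ ^ A * R₀ * C₀ := by
  have hspec := hF.blockComp_spec (pruneSeq A) hh0 hKT K (by simp) 1 Z
  simp only [sub_self] at hspec
  rw [hspec, add_sub_cancel_left]
  exact M.abs_pruningRemainder_le hR₀ hC₀ hβ hFb hA hγ0 hγ hh0 hsmall K hKT Z

end HierarchyModel

end Pruning

end Kinetic



end

end Literature.MathematicalPhysics.KineticTheory
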